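import Summits.NavierStokesRegularity.NavierStokesRegularity.Theses.RellichScar
import Summits.NavierStokesRegularity.NavierStokesRegularity.Theses.RecurrentProfiles
import Summits.NavierStokesRegularity.NavierStokesRegularity.Theorems.RecurrentProfilesRecurrentReduction

/-!
# Crux-strategist sketch — `RellichScar.ApexLocalisation` (stmt-NavierStokesRegularity-11719)

Typed forms of the STRENGTHEN / DECOMPOSITION attempts of `STRATEGY-CENSUS.md` (this seat,
2026-08-17). Nothing here is a registered line; the file only certifies that the candidate
statements elaborate and that the one honest "split" collapses to a single piece.

* `RecurrentApex` (S⁺₂ of the census): a uniformly recurrent (Birkhoff almost periodic under the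
  Navier–Stokes scaling) origin-singular rate profile with `𝐈 < ⊤` is an APEX profile.  Strictly
  between the crux and `RecurrentProfiles.RecurrentLiouville` (stmt-1589).
* `apexLocalisation_of_recurrentApex` : `RecurrentApex → ApexLocalisation`, using the PROVED tree
  theorem `recurrentReduction_proof` (stmt-1590).  This is the best typed decomposition found:
  `crux ⇐ RecurrentReduction ∧ RecurrentApex`, whose first piece is already a theorem — so the
  second piece carries the whole crux (census §Decomposition).
* `ConicalCalmLiouville` (S⁺₄, "lone singular ray"): an origin-singular rate profile cannot be
  apex-calm on every closed cone avoiding one ray.  The sharpest residual of the calm-cone-carleman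
  line (lead a3 §3(d)); open, no mechanism (census §Transfer/§Strengthen).
-/

noncomputable section

open MeasureTheory Set Function Filter Topology
open scoped ENNReal InnerProductSpace RealInnerProductSpace
open Literature.Analysis.FluidPDE
open Summit.NavierStokesRegularity.NavierStokesRegularity.Theses

namespace Summit.NavierStokesRegularity.NavierStokesRegularity.Cruxes.ApexLocalisation.Strategist

/-- Physical space. -/
local notation "E³" => EuclideanSpace ℝ (Fin 3)

/-- The open backward slab `(-∞,0) × ℝ³` (time first), as in the route file. -/
local notation "𝕊" => Literature.Analysis.FluidPDE.slab (EuclideanSpace ℝ (Fin 3)) (Set.Iio (0 : ℝ)) isOpen_Iio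

/-- Uniform recurrence under the Navier–Stokes scaling in `L³_loc({t ≤ 0} × ℝ³)` — verbatim the
hypothesis of `RecurrentProfiles.RecurrentLiouville` / conclusion of `RecurrentReduction`. -/
def IsScalingRecurrent (u : ℝ → E³ → E³) : Prop :=
  ∀ ε : ℝ, 0 < ε → ∀ K : Set (ℝ × E³), IsCompact K → K ⊆ Set.Iic (0 : ℝ) ×ˢ Set.univ →
    ∃ L : ℝ, 0 < L ∧ ∀ a : ℝ, ∃ σ ∈ Set.Icc a (a + L),
      MeasureTheory.eLpNorm (fun z : ℝ × E³ => nsRescale (Real.exp σ) u z.1 z.2 - u z.1 z.2) 3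
        (MeasureTheory.volume.restrict K) ≤ ENNReal.ofReal ε

/-- **S⁺₂ `RecurrentApex`** (strengthening of the crux pinned to Birkhoff-recurrent profiles): a
suitable weak slab solution with `𝐈 < ⊤`, the Type-I RATE, a backward-singular origin and uniform
recurrence under scaling satisfies the SPACE–TIME Type-I bound for some `C'`.
`RecurrentLiouville ⇒ RecurrentApex ⇒ ApexLocalisation` (the second arrow below). Open; its
periodic rung ("a `λ`-DSS rate profile with `𝐈 < ⊤` is apex", i.e. has no singular partner
`λ^k e`) is not covered by `chaeWolf2017_dss_typeI_decay` (that fact ASSUMES `u(t) ∈ Lᵖ`). -/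
def RecurrentApex : Prop :=
  ∀ (u : ℝ → E³ → E³) (p : ℝ → E³ → ℝ) (G : ℝ → E³ → E³ →L[ℝ] E³) (C : ℝ),
    IsSuitableWeakSolutionOn 𝕊 1 0 u p → HasWeakSpatialGradientOn 𝕊 u G →
    typeIBound (Set.Iio (0 : ℝ) ×ˢ Set.univ) u p G < ⊤ → HasTypeITimeDecay C u →
    IsScalingRecurrent u → IsBackwardSingularPoint u 0 → ∃ C' : ℝ, HasTypeIDecay C' u

/-- The collapsed split: `RecurrentApex` alone gives the crux, because the selection half
(`RecurrentReduction`, stmt-1590) is a tree THEOREM (`recurrentReduction_proof`). -/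
theorem apexLocalisation_of_recurrentApex (h : RecurrentApex) : RellichScar.ApexLocalisation := by
  intro C hC
  obtain ⟨u, p, G, hsws, hgrad, hI, hrate, hsing⟩ := hC
  obtain ⟨w, q, H, hw, hq, hIw, hratew, hsingw, hrec⟩ :=
    Theorems.recurrentReduction_proof u p G C hsws hgrad hI hrate hsing
  obtain ⟨C', hC'⟩ := h w q H C hw hq hIw hratew hrec hsingw
  exact ⟨C', w, q, H, hw, hq, hIw, hC', hsingw⟩

/-- `RecurrentLiouville` (stmt-1589, crux of route RecurrentProfiles) implies `RecurrentApex`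
vacuously (no recurrent singular profile exists). Recorded to place S⁺₂ strictly below it. -/
theorem recurrentApex_of_recurrentLiouville (h : RecurrentProfiles.RecurrentLiouville) :
    RecurrentApex := by
  intro u p G C hsws hgrad hI hrate hrec hsing
  exact absurd hsing (h u p G C hsws hgrad hI hrate hrec)

/-- **S⁺₄ `ConicalCalmLiouville`** ("no lone singular ray"): an origin-singular rate profile with
`𝐈 < ⊤` cannot be apex-calm on every closed cone avoiding a single ray `ℝ₊e` — calm meaning
`‖u(t,x)‖ ≤ K_κ/(‖x‖ + √(−t))` whenever `⟪x, e⟫ ≤ κ‖x‖`, for every `κ < 1`. This is the `H* = ray`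
instance of the hereditary-singular-cone enemy (lead a3 §3); the landed K1′ family kills it only
when the trace on a reflex cone is BOUNDED. Open, mechanism-free. -/
def ConicalCalmLiouville : Prop :=
  ∀ (u : ℝ → E³ → E³) (p : ℝ → E³ → ℝ) (G : ℝ → E³ → E³ →L[ℝ] E³) (C : ℝ) (e : E³),
    ‖e‖ = 1 →
    IsSuitableWeakSolutionOn 𝕊 1 0 u p → HasWeakSpatialGradientOn 𝕊 u G →
    typeIBound (Set.Iio (0 : ℝ) ×ˢ Set.univ) u p G < ⊤ → HasTypeITimeDecay C u →
    (∀ κ : ℝ, κ < 1 → ∃ K : ℝ, ∀ t : ℝ, t < 0 → ∀ x : E³, ⟪x, e⟫_ℝ ≤ κ * ‖x‖ →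
        ‖u t x‖ ≤ K / (‖x‖ + Real.sqrt (-t))) →
    ¬ IsBackwardSingularPoint u 0

/-- Sanity: an apex profile is calm on every such cone (so `ConicalCalmLiouville` is at least as
strong as "no apex singular profile off a ray" — it does NOT follow from the crux). -/
example {u : ℝ → E³ → E³} {C' : ℝ} (h : HasTypeIDecay C' u) (e : E³) :
    ∀ κ : ℝ, κ < 1 → ∃ K : ℝ, ∀ t : ℝ, t < 0 → ∀ x : E³, ⟪x, e⟫_ℝ ≤ κ * ‖x‖ →
        ‖u t x‖ ≤ K / (‖x‖ + Real.sqrt (-t)) :=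
  fun _ _ => ⟨C', fun t ht x _ => h t ht x⟩

end Summit.NavierStokesRegularity.NavierStokesRegularity.Cruxes.ApexLocalisation.Strategist
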